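import Literature.Probability.LatticeModels.IntersectionPropertyCore
import Literature.Probability.LatticeModels.CurrentsPartialMonotonicity
import Literature.Probability.LatticeModels.SourcedDoubleCurrentsSwitching
import HarnessLib

/-!
# One-arm moments of the sourced double-current cluster in a box (Aizenman–Duminil-Copin 2021, Prop. A.3 and the second-moment method of Lemma 4.4)

Topic `Literature/Probability/LatticeModels`. Theorems only; no definition and no named fact is
introduced. For the sourced double current `(n₁, n₂) ∼ P^{{a}∆{b},∅}_{Λ_L,β}` of the free box
`Λ_L ⊂ ℤ^d` (`β ≥ 0`; the tree's `doubleCurrentMeasure (freeBoxGraph d L)` and its trace law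
`sourcedDoubleCurrentLaw d L β ({a}∆{b}) ∅`), the cluster `C = C_{n₁+n₂}(a)` and a set `A ⊆ Λ_L`, the
one-arm count `X = #(C ∩ A)` and a pair functional `I_φ = ∑_{u ≠ v ∈ C ∩ A} φ(u,v)` (`φ ≥ 0`; for
`φ(u,v) = ‖u−v‖^{−s}` the Riesz `s`-energy) satisfy, with `G = ⟨σσ⟩^∅_{Λ_L,β}`,

* `E X = M₁ := ∑_{v ∈ A} G(a,v)G(v,b)/G(a,b)` EXACTLY — M. Aizenman, H. Duminil-Copin, Ann. of Math.
  **194** (2021), arXiv:1912.07973, App. A Prop. A.3, first display: "`P^{0x,∅}_β[u ↔ 0] =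
  ⟨σ₀σ_u⟩⟨σ_uσ_x⟩/⟨σ₀σ_x⟩`" (the switching lemma; tree `Current.tsum_epairWeight_mul_indicator_mem_cluster`);
* `E X² ≤ M₂ := ∑_{v,w ∈ A} B_{ab}(v,w)/G(a,b)` and `E I_φ ≤ E_φ := ∑_{v ≠ w ∈ A} φ(v,w) B_{ab}(v,w)/G(a,b)`,
  `B_{ab}(v,w) = G(a,v)G(v,w)G(w,b) + G(a,w)G(w,v)G(v,b)` — Prop. A.3, second display:
  "`P^{0x,∅}_β[u, v ↔ 0] ≤ (⟨σ₀σ_v⟩⟨σ_vσ_u⟩⟨σ_uσ_x⟩ + ⟨σ₀σ_u⟩⟨σ_uσ_v⟩⟨σ_vσ_x⟩)/⟨σ₀σ_x⟩`"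
  (tree `Current.ecurrentSum_empty_mul_tsum_connInd_mul_connInd_le`), summed over pairs;

whence, by the second-moment (Cauchy–Schwarz) inequality of §4.2, proof of Lemma 4.4 ("`P[𝓜 ≠ ∅] ≥
E[|𝓜|]²/E[|𝓜|²]`", tree `Current.tsum_mul_sq_le_tsum_indicator_mul_tsum_sq`) in the truncated
(Paley–Zygmund) form `(E X − m)² ≤ E[X 𝟙{X ≥ m}]² ≤ P[X ≥ m]·E X²` (`0 ≤ m ≤ M₁`), Markov's inequality
and the union bound, the finite-volume estimate

  `P^{{a}∆{b},∅}_{Λ_L,β}[#(C ∩ A) ≥ m ∧ I_φ(C ∩ A) ≤ t] ≥ (M₁ − m)²/M₂ − E_φ/t`  (`t > 0`)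

(`sourcedDoubleCurrentLaw_real_oneArm_ge`; the cluster is read on the trace as
`{v ∈ Λ_{L+1} | a ↔ v} ∩ A`). Contents: §1 the un-normalised current-sum steps on any finite graph with
couplings `K ≥ 0`; §2 the masses of sets under `doubleCurrentMeasure`; §3 the box dictionary
(`G = Z[·]/Z[∅]`, `isingTwoPoint_free_box_eq_boxGraph` + `isingTwoPoint_free_eq_currentSum_div_holds`; the
trace cluster read in the box graph, `liftBonds_mem_openConn_iff`), the normalisations of the two
displays, Paley–Zygmund and Markov for box vertices, and the assembled trace-law statement (the
push-forward under the lifted trace is bounded below through `Measure.le_map_apply`, so no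
measurability of the event is needed; the degenerate case `G(a,b) = 0` holds by `x/0 = 0`). The box
two-point function enters through an arbitrary `G` agreeing with `⟨σσ⟩^∅_{Λ_L,β}` on `Λ_L × Λ_L`, so
that users may instantiate their own abbreviation.

## References

* M. Aizenman, H. Duminil-Copin, Ann. of Math. 194 (2021), arXiv:1912.07973, §3.1–3.2 (sourced
  currents), §4.2 (proof of Lemma 4.4: first and second moment of `|𝓜|`, the second-moment inequality),
  Appendix A.2 (Proposition A.3) [AizenmanDuminilCopinAnnals2021].
-/

noncomputable section

open Filter Topology Set Function MeasureTheory Finset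
open Literature.Probability.Percolation
open scoped symmDiff ENNReal

namespace Literature.Probability.LatticeModels

/-! ### §1. The un-normalised moment steps on a finite graph -/

section Unnormalised

variable {V : Type*} [Fintype V] [DecidableEq V] {G : SimpleGraph V} [DecidableRel G.Adj]
  {K : G.edgeFinset → ℝ}

namespace Current

/-- **First moment of the one-arm count** `#(C_{n₁+n₂}(a) ∩ A)` under the un-normalised weight
`1{∂n₁={a}∆{b}}1{∂n₂=∅} w w` (Prop. A.3, first display, summed over `A`): `∑ W N = ∑_{v ∈ A} Z[bv] Z[av]`.
[cite: AizenmanDuminilCopinAnnals2021, arXiv:1912.07973 Appendix A.2, Proposition A.3 (first display)] -/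
theorem tsum_epairWeight_mul_clusterCount (hK : ∀ e, 0 ≤ K e) (A : Finset V) (a b : V) :
    ∑' p : Current G × Current G, epairWeight K ({a} ∆ {b}) ∅ p * (∑ v ∈ A, connInd v a p) =
      ∑ v ∈ A, ecurrentSum K ({b} ∆ {v}) * ecurrentSum K ({a} ∆ {v}) := by
  simp_rw [Finset.mul_sum]
  rw [Summable.tsum_finsetSum (fun _ _ => ENNReal.summable)]
  refine Finset.sum_congr rfl fun v _ => ?_
  unfold connInd
  exact tsum_epairWeight_mul_indicator_mem_cluster hK a b v

/-- **Weighted pair moments of the one-arm cluster**, un-normalised (Prop. A.3, second display, summed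
over pairs with weights `c ≥ 0`):
`Z[∅] ∑ W (∑_{v} ∑_{w ∈ B v} c(v,w) 𝟙[v ∈ C(a)]𝟙[w ∈ C(a)]) ≤ ∑_{v} ∑_{w ∈ B v} c(v,w) B_{ab}(v,w)`.
[cite: AizenmanDuminilCopinAnnals2021, arXiv:1912.07973 Appendix A.2, Proposition A.3 (second display)] -/
theorem ecurrentSum_empty_mul_tsum_weightedPairs_le (hK : ∀ e, 0 ≤ K e) (A : Finset V)
    (B : V → Finset V) (c : V → V → ℝ≥0∞) (a b : V) :
    ecurrentSum K ∅ * ∑' p : Current G × Current G, epairWeight K ({a} ∆ {b}) ∅ p *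
        (∑ v ∈ A, ∑ w ∈ B v, c v w * (connInd v a p * connInd w a p)) ≤
      ∑ v ∈ A, ∑ w ∈ B v, c v w * twoStepBound K a b v w := by
  simp_rw [Finset.mul_sum]
  rw [Summable.tsum_finsetSum (fun _ _ => ENNReal.summable), Finset.mul_sum]
  refine Finset.sum_le_sum fun v _ => ?_
  rw [Summable.tsum_finsetSum (fun _ _ => ENNReal.summable), Finset.mul_sum]
  refine Finset.sum_le_sum fun w _ => ?_
  have h : ∑' p : Current G × Current G,
      epairWeight K ({a} ∆ {b}) ∅ p * (c v w * (connInd v a p * connInd w a p)) =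
      c v w * ∑' p : Current G × Current G,
        epairWeight K ({a} ∆ {b}) ∅ p * (connInd v a p * connInd w a p) := by
    rw [← ENNReal.tsum_mul_left]
    exact tsum_congr fun p => by ring
  rw [h, mul_left_comm]
  exact mul_le_mul' le_rfl (ecurrentSum_empty_mul_tsum_connInd_mul_connInd_le hK a b v w)

/-- **The truncated second-moment (Cauchy–Schwarz) inequality** for weighted sums in `ℝ≥0∞`: for a
`{0,1}`-valued `χ`, `(∑ w n χ)² ≤ (∑ w χ)(∑ w n²)` — `E[N 𝟙_S]² ≤ P[S] E[N²]` (Paley–Zygmund form of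
"`P[𝓜 ≠ ∅] ≥ E[|𝓜|]²/E[|𝓜|²]`"). [cite: AizenmanDuminilCopinAnnals2021, arXiv:1912.07973 §4.2, proof of Lemma 4.4 (second-moment inequality)] -/
theorem tsum_mul_mul_sq_le_of_zero_or_one {ι : Type*} (w n χ : ι → ℝ≥0∞)
    (hχ : ∀ i, χ i = 0 ∨ χ i = 1) :
    (∑' i, w i * (n i * χ i)) ^ 2 ≤ (∑' i, w i * χ i) * ∑' i, w i * n i ^ 2 := by
  refine (tsum_mul_sq_le_tsum_indicator_mul_tsum_sq w fun i => n i * χ i).trans ?_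
  refine mul_le_mul' (ENNReal.tsum_le_tsum fun i => mul_le_mul' le_rfl ?_)
    (ENNReal.tsum_le_tsum fun i => mul_le_mul' le_rfl ?_)
  · rcases hχ i with h | h
    · rw [h, mul_zero, if_pos rfl]
    · rw [h]
      split_ifs
      · exact zero_le_one
      · exact le_rfl
  · rcases hχ i with h | h
    · rw [h, mul_zero, zero_pow two_ne_zero]
      exact bot_le
    · rw [h, mul_one]

end Current

end Unnormalised

/-! ### §2. Masses of sets under `doubleCurrentMeasure` -/

section DCM

variable {V : Type*} [Fintype V] [DecidableEq V] (G : SimpleGraph V) [DecidableRel G.Adj]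

/-- The tree's real pair weight, cast to `ℝ≥0∞`, is the `ℝ≥0∞` pair weight of the constant coupling.
[folklore] -/
theorem ofReal_pairWeight_eq_epairWeight_const (β : ℝ) (hβ : 0 ≤ β) (A B : Finset V)
    (p : Current G × Current G) :
    ENNReal.ofReal (pairWeight G β A B p) = epairWeight (fun _ : G.edgeFinset => β) A B p := by
  unfold pairWeight epairWeight Current.eweight
  split_ifs with h
  · rw [ENNReal.ofReal_mul (Current.weight_nonneg hβ _)]
    rfl
  · exact ENNReal.ofReal_zero

/-- **The singleton masses of the double-current measure**, `P^{A,B}{p} = w_{A,B}(p)/(Z[A] Z[B])` in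
`ℝ≥0∞`, when currents with the prescribed sources exist (`β ≥ 0`). [cite: AizenmanDuminilCopinAnnals2021, arXiv:1912.07973 §3.1 (the measures P^A_{Λ,β}, P^{A₁,…,A_i}_{Λ,β})] -/
theorem doubleCurrentMeasure_singleton_eq_div (β : ℝ) (hβ : 0 ≤ β) (A B : Finset V)
    (hA : currentSum G β A ≠ 0) (hB : currentSum G β B ≠ 0) (p : Current G × Current G) :
    doubleCurrentMeasure G β A B {p} =
      epairWeight (fun _ : G.edgeFinset => β) A B p /
        (ecurrentSum (fun _ : G.edgeFinset => β) A * ecurrentSum (fun _ : G.edgeFinset => β) B) := by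
  have hZ : 0 < currentSum G β A * currentSum G β B :=
    mul_pos (lt_of_le_of_ne (currentSum_nonneg G hβ A) (Ne.symm hA))
      (lt_of_le_of_ne (currentSum_nonneg G hβ B) (Ne.symm hB))
  rw [doubleCurrentMeasure, Measure.sum_apply _ (measurableSet_singleton p)]
  simp only [Measure.smul_apply, smul_eq_mul, Measure.dirac_apply, Set.indicator_apply,
    Set.mem_singleton_iff, Pi.one_apply, mul_ite, mul_one, mul_zero]
  rw [tsum_ite_eq, ENNReal.ofReal_div_of_pos hZ, ENNReal.ofReal_mul (currentSum_nonneg G hβ A),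
    ofReal_pairWeight_eq_epairWeight_const G β hβ, currentSum_eq_wcurrentSum, currentSum_eq_wcurrentSum,
    ← ecurrentSum_eq_ofReal (fun _ => hβ), ← ecurrentSum_eq_ofReal (fun _ => hβ)]

/-- **The mass of an arbitrary set of pairs of currents** under the double-current measure:
`P^{A,B}[S] = (∑ 1{∂n₁=A}1{∂n₂=B} w w 𝟙_S)/(Z[A] Z[B])` (`β ≥ 0`, nondegenerate normalisers).
[cite: AizenmanDuminilCopinAnnals2021, arXiv:1912.07973 §3.1 (the measures P^A_{Λ,β}, P^{A₁,…,A_i}_{Λ,β})] -/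
theorem doubleCurrentMeasure_apply_eq_tsum_epairWeight_div (β : ℝ) (hβ : 0 ≤ β) (A B : Finset V)
    (hA : currentSum G β A ≠ 0) (hB : currentSum G β B ≠ 0) (S : Set (Current G × Current G)) :
    doubleCurrentMeasure G β A B S =
      (∑' p, epairWeight (fun _ : G.edgeFinset => β) A B p * S.indicator 1 p) /
        (ecurrentSum (fun _ : G.edgeFinset => β) A * ecurrentSum (fun _ : G.edgeFinset => β) B) := by
  rw [← Measure.tsum_indicator_apply_singleton _ S S.to_countable.measurableSet, div_eq_mul_inv,
    ← ENNReal.tsum_mul_right]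
  refine tsum_congr fun p => ?_
  by_cases hp : p ∈ S
  · rw [Set.indicator_of_mem hp, Set.indicator_of_mem hp, Pi.one_apply, mul_one,
      doubleCurrentMeasure_singleton_eq_div G β hβ A B hA hB, div_eq_mul_inv]
  · rw [Set.indicator_of_notMem hp, Set.indicator_of_notMem hp, mul_zero, zero_mul]

end DCM

/-! ### §3. The free box `Λ_L ⊂ ℤ^d`: dictionary, normalisations, Paley–Zygmund, Markov -/

section Box

variable {d : ℕ} (L : ℕ) {β : ℝ}

/-- **The free box two-point function as a ratio of `ℝ≥0∞` current sums of the free box graph**,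
`⟨σ_xσ_y⟩^∅_{Λ_L,β} = Z[{x}∆{y}]/Z[∅]` for `x, y ∈ Λ_L` (random-current representation, `β ≥ 0`).
[cite: AizenmanDuminilCopinAnnals2021, arXiv:1912.07973 §3.2, eq. (3.5) (⟨σ_xσ_y⟩ = Z[xy]/Z[∅])] -/
theorem isingTwoPoint_free_box_eq_toReal_div (hβ : 0 ≤ β) (x y : BoxVertex d L)
    (hx : (x : Site d) ∈ box d L) (hy : (y : Site d) ∈ box d L) :
    isingTwoPoint (zdGraph d) (box d L) β 0 .free x y =
      (ecurrentSum (fun _ : (freeBoxGraph d L).edgeFinset => β) ({x} ∆ {y})).toReal /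
        (ecurrentSum (fun _ : (freeBoxGraph d L).edgeFinset => β) ∅).toReal := by
  have hK : ∀ e : (freeBoxGraph d L).edgeFinset, 0 ≤ (fun _ : (freeBoxGraph d L).edgeFinset => β) e :=
    fun _ => hβ
  rw [isingTwoPoint_free_box_eq_boxGraph d L _ x y hx hy,
    isingTwoPoint_free_eq_currentSum_div_holds (freeBoxGraph d L) β x y,
    currentSum_eq_wcurrentSum, currentSum_eq_wcurrentSum, toReal_ecurrentSum hK, toReal_ecurrentSum hK]

/-- Sums over `A ⊆ Λ_{L+1}` as sums over the box vertices `boxSources A`. [folklore] -/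
theorem sum_eq_sum_boxSources {A : Finset (Site d)} (hA : A ⊆ box d (L + 1)) (f : Site d → ℝ) :
    ∑ v ∈ A, f v = ∑ v ∈ boxSources d L A, f (v : Site d) := by
  conv_lhs => rw [← map_boxEmb_boxSources d hA]
  rw [Finset.sum_map]
  rfl

/-- Sums over `A ∖ {v}` as sums over box vertices. [folklore] -/
theorem sum_erase_eq_sum_boxSources {A : Finset (Site d)} (hA : A ⊆ box d (L + 1)) (f : Site d → ℝ)
    (v : BoxVertex d L) :
    ∑ w ∈ A.erase (v : Site d), f w = ∑ w ∈ (boxSources d L A).erase v, f (w : Site d) := by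
  have h : A.erase (v : Site d) = ((boxSources d L A).erase v).map (boxEmb d L) := by
    rw [Finset.map_erase, boxEmb_apply, map_boxEmb_boxSources d hA]
  rw [h, Finset.sum_map]
  rfl

/-- A pair functional of the image of a set of box vertices, as a double sum over box vertices.
[folklore] -/
theorem sum_map_boxEmb_erase (φ : Site d → Site d → ℝ) (S : Finset (BoxVertex d L)) :
    ∑ u ∈ S.map (boxEmb d L), ∑ v ∈ (S.map (boxEmb d L)).erase u, φ u v =
      ∑ u ∈ S, ∑ v ∈ S.erase u, φ u v := by
  rw [Finset.sum_map]
  refine Finset.sum_congr rfl fun u _ => ?_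
  rw [← Finset.map_erase, Finset.sum_map]
  rfl

open Classical in
/-- **The trace cluster read in the box graph**: for a pair of currents `p` of the free box graph, a
box vertex `a` and a set of sites `A`, `{v ∈ Λ_{L+1} | a ↔ v in the lifted trace of p₁+p₂} ∩ A` is the
image of `{v ∈ A | v ∈ C_{p₁+p₂}(a)}` (lifting does not change connections,
`liftBonds_mem_openConn_iff`). [folklore] -/
theorem filter_openConn_sourcedTrace_inter (a : BoxVertex d L) (A : Finset (Site d))
    (p : Current (freeBoxGraph d L) × Current (freeBoxGraph d L)) :
    ((box d (L + 1)).filter fun v => sourcedTrace d L p ∈ openConn (a : Site d) v) ∩ A =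
      ((boxSources d L A).filter fun v => v ∈ (p.1 + p.2).cluster a).map (boxEmb d L) := by
  ext x
  simp only [Finset.mem_inter, Finset.mem_filter, Finset.mem_map, mem_boxSources_iff, boxEmb_apply]
  constructor
  · rintro ⟨⟨hx, hconn⟩, hxA⟩
    refine ⟨⟨x, hx⟩, ⟨hxA, ?_⟩, rfl⟩
    rw [Current.mem_cluster_iff]
    exact (liftBonds_mem_openConn_iff d _ a ⟨x, hx⟩).1 hconn
  · rintro ⟨v, ⟨hvA, hv⟩, rfl⟩
    refine ⟨⟨v.2, ?_⟩, hvA⟩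
    rw [Current.mem_cluster_iff] at hv
    exact (liftBonds_mem_openConn_iff d _ a v).2 hv

variable (a b : BoxVertex d L) (G : Site d → Site d → ℝ)

/-- Nondegeneracy: if `G(a,b) = Z[ab]/Z[∅] ≠ 0` then currents of the box with sources `{a}∆{b}` (and
sourceless ones) exist, so `P^{{a}∆{b},∅}_{Λ_L}` is a genuine probability measure (`β ≥ 0`). [folklore] -/
theorem currentSum_ne_zero_of_ratio_ne_zero (hβ : 0 ≤ β)
    (hGab : G a b = (ecurrentSum (fun _ : (freeBoxGraph d L).edgeFinset => β) ({a} ∆ {b})).toReal /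
      (ecurrentSum (fun _ : (freeBoxGraph d L).edgeFinset => β) ∅).toReal) (hab : G a b ≠ 0) :
    ecurrentSum (fun _ : (freeBoxGraph d L).edgeFinset => β) ({a} ∆ {b}) ≠ 0 ∧
    currentSum (freeBoxGraph d L) β ({a} ∆ {b}) ≠ 0 ∧ currentSum (freeBoxGraph d L) β ∅ ≠ 0 := by
  have hK : ∀ e : (freeBoxGraph d L).edgeFinset, 0 ≤ (fun _ : (freeBoxGraph d L).edgeFinset => β) e :=
    fun _ => hβ
  have hcs : ∀ S, ecurrentSum (fun _ : (freeBoxGraph d L).edgeFinset => β) S ≠ 0 →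
      currentSum (freeBoxGraph d L) β S ≠ 0 := fun S hS => by
    rw [currentSum_eq_wcurrentSum, ← toReal_ecurrentSum hK]
    exact (ENNReal.toReal_pos hS (ecurrentSum_ne_top hK S)).ne'
  have hZab : ecurrentSum (fun _ : (freeBoxGraph d L).edgeFinset => β) ({a} ∆ {b}) ≠ 0 :=
    fun h => hab (by rw [hGab, h, ENNReal.toReal_zero, zero_div])
  exact ⟨hZab, hcs _ hZab, hcs _ (ecurrentSum_empty_ne_zero _)⟩

/-- **The real mass of a set of pairs of currents under `P^{{a}∆{b},∅}_{Λ_L,β}`** (nondegenerate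
normalisers): `P[S] = (∑ W 𝟙_S).toReal / (Z[ab].toReal Z[∅].toReal)`. [cite: AizenmanDuminilCopinAnnals2021, arXiv:1912.07973 §3.1 (the measures P^A_{Λ,β}, P^{A₁,…,A_i}_{Λ,β})] -/
theorem doubleCurrentMeasure_real_eq_toReal_div (hβ : 0 ≤ β)
    (hA : currentSum (freeBoxGraph d L) β ({a} ∆ {b}) ≠ 0) (hB : currentSum (freeBoxGraph d L) β ∅ ≠ 0)
    (S : Set (Current (freeBoxGraph d L) × Current (freeBoxGraph d L))) :
    (doubleCurrentMeasure (freeBoxGraph d L) β ({a} ∆ {b}) ∅).real S =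
      (∑' p, epairWeight (fun _ : (freeBoxGraph d L).edgeFinset => β) ({a} ∆ {b}) ∅ p *
          S.indicator 1 p).toReal /
        ((ecurrentSum (fun _ : (freeBoxGraph d L).edgeFinset => β) ({a} ∆ {b})).toReal *
          (ecurrentSum (fun _ : (freeBoxGraph d L).edgeFinset => β) ∅).toReal) := by
  rw [measureReal_def, doubleCurrentMeasure_apply_eq_tsum_epairWeight_div _ _ hβ _ _ hA hB,
    ENNReal.toReal_div, ENNReal.toReal_mul]

/-- **Normalisation of the first display of Prop. A.3**: if `G = Z[·]/Z[∅]` on `Λ_L` and `G(a,b) ≠ 0`,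
`∑_{v ∈ A'} Z[bv] Z[av] = (∑_{v ∈ A'} G(a,v)G(v,b)/G(a,b)) · Z[ab] Z[∅]` for `A' ⊆ Λ_L`.
[cite: AizenmanDuminilCopinAnnals2021, arXiv:1912.07973 Appendix A.2, Proposition A.3 (first display)] -/
theorem toReal_sum_currentSum_pair_mul (hβ : 0 ≤ β) (ha : (a : Site d) ∈ box d L)
    (hb : (b : Site d) ∈ box d L)
    (hG : ∀ x y : BoxVertex d L, (x : Site d) ∈ box d L → (y : Site d) ∈ box d L →
      G x y = (ecurrentSum (fun _ : (freeBoxGraph d L).edgeFinset => β) ({x} ∆ {y})).toReal /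
        (ecurrentSum (fun _ : (freeBoxGraph d L).edgeFinset => β) ∅).toReal)
    (hab : G a b ≠ 0) (A' : Finset (BoxVertex d L)) (hA' : ∀ v ∈ A', (v : Site d) ∈ box d L) :
    (∑ v ∈ A', ecurrentSum (fun _ : (freeBoxGraph d L).edgeFinset => β) ({b} ∆ {v}) *
        ecurrentSum (fun _ : (freeBoxGraph d L).edgeFinset => β) ({a} ∆ {v})).toReal =
      (∑ v ∈ A', G a v * G v b / G a b) *
        ((ecurrentSum (fun _ : (freeBoxGraph d L).edgeFinset => β) ({a} ∆ {b})).toReal *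
          (ecurrentSum (fun _ : (freeBoxGraph d L).edgeFinset => β) ∅).toReal) := by
  set Z : Finset (BoxVertex d L) → ℝ≥0∞ :=
    ecurrentSum (fun _ : (freeBoxGraph d L).edgeFinset => β) with hZdef
  have hZtop : ∀ S, Z S ≠ ∞ := fun S => ecurrentSum_ne_top (fun _ => hβ) S
  have hr0 : (Z ∅).toReal ≠ 0 := (ENNReal.toReal_pos (ecurrentSum_empty_ne_zero _) (hZtop _)).ne'
  have hrab : (Z ({a} ∆ {b})).toReal ≠ 0 := fun h => hab (by rw [hG a b ha hb, h, zero_div])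
  rw [ENNReal.toReal_sum (fun v _ => ENNReal.mul_ne_top (hZtop _) (hZtop _)), Finset.sum_mul]
  refine Finset.sum_congr rfl fun v hv => ?_
  have hvb := hA' v hv
  rw [ENNReal.toReal_mul, hG a v ha hvb, hG v b hvb hb, hG a b ha hb,
    symmDiff_comm ({b} : Finset (BoxVertex d L)) {v}]
  field_simp

/-- **Normalisation of the second display of Prop. A.3** (weighted, summed over pairs): if
`G = Z[·]/Z[∅]` on `Λ_L` and `G(a,b) ≠ 0`, then for finite weights `c`,
`∑_{v} ∑_{w ∈ B v} c(v,w) B_{ab}(v,w) = (∑_{v} ∑_{w ∈ B v} c(v,w) · twoStep(v,w)/G(a,b)) · Z[∅]² Z[ab]`,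
`twoStep(v,w) = G(a,v)G(v,w)G(w,b) + G(a,w)G(w,v)G(v,b)`.
[cite: AizenmanDuminilCopinAnnals2021, arXiv:1912.07973 Appendix A.2, Proposition A.3 (second display)] -/
theorem toReal_sum_mul_twoStepBound (hβ : 0 ≤ β) (ha : (a : Site d) ∈ box d L)
    (hb : (b : Site d) ∈ box d L)
    (hG : ∀ x y : BoxVertex d L, (x : Site d) ∈ box d L → (y : Site d) ∈ box d L →
      G x y = (ecurrentSum (fun _ : (freeBoxGraph d L).edgeFinset => β) ({x} ∆ {y})).toReal /
        (ecurrentSum (fun _ : (freeBoxGraph d L).edgeFinset => β) ∅).toReal)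
    (hab : G a b ≠ 0) (A' : Finset (BoxVertex d L)) (B : BoxVertex d L → Finset (BoxVertex d L))
    (hA' : ∀ v ∈ A', (v : Site d) ∈ box d L) (hB : ∀ v ∈ A', ∀ w ∈ B v, (w : Site d) ∈ box d L)
    (c : BoxVertex d L → BoxVertex d L → ℝ≥0∞) (hc : ∀ v w, c v w ≠ ∞) :
    (∑ v ∈ A', ∑ w ∈ B v,
        c v w * Current.twoStepBound (fun _ : (freeBoxGraph d L).edgeFinset => β) a b v w).toReal =
      (∑ v ∈ A', ∑ w ∈ B v, (c v w).toReal *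
          ((G a v * G v w * G w b + G a w * G w v * G v b) / G a b)) *
        ((ecurrentSum (fun _ : (freeBoxGraph d L).edgeFinset => β) ∅).toReal *
          ((ecurrentSum (fun _ : (freeBoxGraph d L).edgeFinset => β) ({a} ∆ {b})).toReal *
            (ecurrentSum (fun _ : (freeBoxGraph d L).edgeFinset => β) ∅).toReal)) := by
  have hK : ∀ e : (freeBoxGraph d L).edgeFinset, 0 ≤ (fun _ : (freeBoxGraph d L).edgeFinset => β) e :=
    fun _ => hβ
  set Z : Finset (BoxVertex d L) → ℝ≥0∞ :=
    ecurrentSum (fun _ : (freeBoxGraph d L).edgeFinset => β) with hZdef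
  have hZtop : ∀ S, Z S ≠ ∞ := fun S => ecurrentSum_ne_top hK S
  have hr0 : (Z ∅).toReal ≠ 0 := (ENNReal.toReal_pos (ecurrentSum_empty_ne_zero _) (hZtop _)).ne'
  have hrab : (Z ({a} ∆ {b})).toReal ≠ 0 := fun h => hab (by rw [hG a b ha hb, h, zero_div])
  rw [ENNReal.toReal_sum (fun v hv => ENNReal.sum_ne_top.2 fun w _ =>
    ENNReal.mul_ne_top (hc v w) (Current.twoStepBound_ne_top' hK a b v w)), Finset.sum_mul]
  refine Finset.sum_congr rfl fun v hv => ?_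
  have hvb := hA' v hv
  rw [ENNReal.toReal_sum (fun w _ => ENNReal.mul_ne_top (hc v w) (Current.twoStepBound_ne_top' hK a b v w)),
    Finset.sum_mul]
  refine Finset.sum_congr rfl fun w hw => ?_
  have hwb := hB v hv w hw
  have h3top : ∀ s t u : Finset (BoxVertex d L), Z s * Z t * Z u ≠ ∞ := fun s t u =>
    ENNReal.mul_ne_top (ENNReal.mul_ne_top (hZtop _) (hZtop _)) (hZtop _)
  rw [ENNReal.toReal_mul, Current.twoStepBound, ENNReal.toReal_add (h3top _ _ _) (h3top _ _ _)]
  simp only [ENNReal.toReal_mul]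
  rw [hG a v ha hvb, hG v w hvb hwb, hG w b hwb hb, hG a w ha hwb, hG w v hwb hvb, hG v b hvb hb,
    hG a b ha hb]
  field_simp

variable (A : Finset (Site d))

/-- **Paley–Zygmund for the one-arm count in the box** (nondegenerate case, `G = Z[·]/Z[∅]` on `Λ_L`,
`G(a,b) ≠ 0`, `A ⊆ Λ_L`): for `0 ≤ m ≤ M₁ = ∑_{v ∈ A} G(a,v)G(v,b)/G(a,b)`,
`(M₁ − m)²/M₂ ≤ P^{{a}∆{b},∅}_{Λ_L,β}[#(C(a) ∩ A) ≥ m]`, `M₂ = ∑_{v,w ∈ A} twoStep(v,w)/G(a,b)` — `E X = M₁`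
exactly (switching), `E X² ≤ M₂` (Prop. A.3), `(E X − m)² ≤ E[X 𝟙{X ≥ m}]² ≤ P[X ≥ m] E X²`.
[cite: AizenmanDuminilCopinAnnals2021, arXiv:1912.07973 §4.2, proof of Lemma 4.4 (second-moment inequality) and Appendix A.2, Proposition A.3] -/
theorem doubleCurrentMeasure_real_clusterCount_ge (hβ : 0 ≤ β) (ha : (a : Site d) ∈ box d L)
    (hb : (b : Site d) ∈ box d L)
    (hG : ∀ x y : BoxVertex d L, (x : Site d) ∈ box d L → (y : Site d) ∈ box d L →
      G x y = (ecurrentSum (fun _ : (freeBoxGraph d L).edgeFinset => β) ({x} ∆ {y})).toReal /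
        (ecurrentSum (fun _ : (freeBoxGraph d L).edgeFinset => β) ∅).toReal)
    (hab : G a b ≠ 0) (hA : A ⊆ box d L) {m : ℝ} (hm0 : 0 ≤ m)
    (hm : m ≤ ∑ v ∈ A, G a v * G v b / G a b) :
    (∑ v ∈ A, G a v * G v b / G a b - m) ^ 2 /
        (∑ v ∈ A, ∑ w ∈ A, (G a v * G v w * G w b + G a w * G w v * G v b) / G a b) ≤
      (doubleCurrentMeasure (freeBoxGraph d L) β ({a} ∆ {b}) ∅).real
        {p | m ≤ (((boxSources d L A).filter fun v => v ∈ (p.1 + p.2).cluster a).card : ℝ)} := by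
  set K : (freeBoxGraph d L).edgeFinset → ℝ := fun _ => β with hKdef
  have hK : ∀ e', 0 ≤ K e' := fun _ => hβ
  set Z : Finset (BoxVertex d L) → ℝ≥0∞ := ecurrentSum K with hZdef
  have hZtop : ∀ S, Z S ≠ ∞ := fun S => ecurrentSum_ne_top hK S
  have hZ0 : Z ∅ ≠ 0 := ecurrentSum_empty_ne_zero K
  obtain ⟨hZab, hcsab, hcs0⟩ := currentSum_ne_zero_of_ratio_ne_zero L a b G hβ (hG a b ha hb) hab
  have hr0 : 0 < (Z ∅).toReal := ENNReal.toReal_pos hZ0 (hZtop _)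
  have hrab : 0 < (Z ({a} ∆ {b})).toReal := ENNReal.toReal_pos hZab (hZtop _)
  set z : ℝ := (Z ({a} ∆ {b})).toReal * (Z ∅).toReal with hzdef
  have hzpos : 0 < z := mul_pos hrab hr0
  have hA1 : A ⊆ box d (L + 1) := hA.trans (box_subset_box_succ d L)
  set A' : Finset (BoxVertex d L) := boxSources d L A with hA'def
  have hA'box : ∀ v ∈ A', (v : Site d) ∈ box d L := fun v hv => hA (mem_boxSources_iff.1 hv)
  set M₁ : ℝ := ∑ v ∈ A, G a v * G v b / G a b with hM₁def
  set M₂ : ℝ := ∑ v ∈ A, ∑ w ∈ A, (G a v * G v w * G w b + G a w * G w v * G v b) / G a b with hM₂def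
  -- the weight `W`, the count `N`, the truncation `χ`
  set W : Current (freeBoxGraph d L) × Current (freeBoxGraph d L) → ℝ≥0∞ :=
    fun p => epairWeight K ({a} ∆ {b}) ∅ p with hWdef
  set F : Current (freeBoxGraph d L) × Current (freeBoxGraph d L) → Finset (BoxVertex d L) :=
    fun p => A'.filter fun v => v ∈ (p.1 + p.2).cluster a with hFdef
  set N : Current (freeBoxGraph d L) × Current (freeBoxGraph d L) → ℝ≥0∞ :=
    fun p => ∑ v ∈ A', Current.connInd v a p with hNdef
  set Sm : Set (Current (freeBoxGraph d L) × Current (freeBoxGraph d L)) :=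
    {p | m ≤ ((F p).card : ℝ)} with hSmdef
  set χ : Current (freeBoxGraph d L) × Current (freeBoxGraph d L) → ℝ≥0∞ := Sm.indicator 1
    with hχdef
  have hχ01 : ∀ p, χ p = 0 ∨ χ p = 1 := fun p => by
    by_cases hp : p ∈ Sm
    · exact Or.inr (by rw [hχdef, Set.indicator_of_mem hp, Pi.one_apply])
    · exact Or.inl (by rw [hχdef, Set.indicator_of_notMem hp])
  have hχle : ∀ p, χ p ≤ 1 := fun p => by
    rcases hχ01 p with h | h
    · rw [h]; exact zero_le_one
    · rw [h]
  have hNF : ∀ p, N p = ((F p).card : ℝ≥0∞) := fun p => by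
    rw [hNdef, hFdef, Finset.natCast_card_filter]
    rfl
  -- §1: first moment, second moment, truncated Cauchy–Schwarz, truncation
  have h1 : ∑' p, W p * N p = ∑ v ∈ A', Z ({b} ∆ {v}) * Z ({a} ∆ {v}) :=
    Current.tsum_epairWeight_mul_clusterCount hK A' a b
  have h2 : Z ∅ * ∑' p, W p * N p ^ 2 ≤ ∑ v ∈ A', ∑ w ∈ A', 1 * Current.twoStepBound K a b v w :=
    calc Z ∅ * ∑' p, W p * N p ^ 2
        = Z ∅ * ∑' p, W p * ∑ v ∈ A', ∑ w ∈ A', 1 * (Current.connInd v a p * Current.connInd w a p) :=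
          by
          congr 1
          refine tsum_congr fun p => ?_
          rw [hNdef, sq, Finset.sum_mul_sum]
          simp only [one_mul]
      _ ≤ _ := Current.ecurrentSum_empty_mul_tsum_weightedPairs_le hK A' (fun _ => A') (fun _ _ => 1) a b
  have hCS : (∑' p, W p * (N p * χ p)) ^ 2 ≤ (∑' p, W p * χ p) * ∑' p, W p * N p ^ 2 :=
    Current.tsum_mul_mul_sq_le_of_zero_or_one W N χ hχ01
  have hWsum : ∑' p, W p = Z ({a} ∆ {b}) * Z ∅ := tsum_epairWeight K _ _
  have htr : ∑' p, W p * N p ≤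
      ∑' p, W p * (N p * χ p) + ENNReal.ofReal m * (Z ({a} ∆ {b}) * Z ∅) := by
    rw [← hWsum, ← ENNReal.tsum_mul_left, ← ENNReal.tsum_add]
    refine ENNReal.tsum_le_tsum fun p => ?_
    rw [mul_comm (ENNReal.ofReal m) (W p), ← mul_add]
    refine mul_le_mul' le_rfl ?_
    by_cases hp : p ∈ Sm
    · rw [hχdef, Set.indicator_of_mem hp, Pi.one_apply, mul_one]
      exact le_self_add
    · rw [hχdef, Set.indicator_of_notMem hp, mul_zero, zero_add, hNF p, ← ENNReal.ofReal_natCast]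
      exact ENNReal.ofReal_le_ofReal (le_of_lt (not_le.1 hp))
  -- finiteness
  have hZn_top : Z ({a} ∆ {b}) * Z ∅ ≠ ∞ := ENNReal.mul_ne_top (hZtop _) (hZtop _)
  have hpm_top : ∑' p, W p * χ p ≠ ∞ := by
    refine ne_top_of_le_ne_top hZn_top ?_
    rw [← hWsum]
    exact ENNReal.tsum_le_tsum fun p => mul_le_of_le_one_right' (hχle p)
  have hEN_top : ∑' p, W p * N p ≠ ∞ := by
    rw [h1]
    exact ENNReal.sum_ne_top.2 fun v _ => ENNReal.mul_ne_top (hZtop _) (hZtop _)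
  have he1_top : ∑' p, W p * (N p * χ p) ≠ ∞ :=
    ne_top_of_le_ne_top hEN_top
      (ENNReal.tsum_le_tsum fun p => mul_le_mul' le_rfl (mul_le_of_le_one_right' (hχle p)))
  have hBB_top : ∑ v ∈ A', ∑ w ∈ A', 1 * Current.twoStepBound K a b v w ≠ ∞ :=
    ENNReal.sum_ne_top.2 fun v _ => ENNReal.sum_ne_top.2 fun w _ =>
      ENNReal.mul_ne_top ENNReal.one_ne_top (Current.twoStepBound_ne_top' hK a b v w)
  have he2_top : ∑' p, W p * N p ^ 2 ≠ ∞ := by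
    intro h
    have h2' := h2
    rw [h, ENNReal.mul_top hZ0, top_le_iff] at h2'
    exact hBB_top h2'
  -- the real forms
  have hCSr : (∑' p, W p * (N p * χ p)).toReal ^ 2 ≤
      (∑' p, W p * χ p).toReal * (∑' p, W p * N p ^ 2).toReal := by
    rw [← ENNReal.toReal_pow, ← ENNReal.toReal_mul]
    exact ENNReal.toReal_mono (ENNReal.mul_ne_top hpm_top he2_top) hCS
  have hM1 : M₁ * z = (∑' p, W p * N p).toReal := by
    rw [h1, toReal_sum_currentSum_pair_mul L a b G hβ ha hb hG hab A' hA'box, hM₁def,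
      sum_eq_sum_boxSources L hA1]
  have htrr : M₁ * z ≤ (∑' p, W p * (N p * χ p)).toReal + m * z := by
    rw [hM1]
    have h := ENNReal.toReal_mono
      (ENNReal.add_ne_top.2 ⟨he1_top, ENNReal.mul_ne_top ENNReal.ofReal_ne_top hZn_top⟩) htr
    rwa [ENNReal.toReal_add he1_top (ENNReal.mul_ne_top ENNReal.ofReal_ne_top hZn_top),
      ENNReal.toReal_mul, ENNReal.toReal_ofReal hm0, ENNReal.toReal_mul] at h
  have hM2 : M₂ * ((Z ∅).toReal * z) =
      (∑ v ∈ A', ∑ w ∈ A', 1 * Current.twoStepBound K a b v w).toReal := by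
    rw [toReal_sum_mul_twoStepBound L a b G hβ ha hb hG hab A' (fun _ => A') hA'box
      (fun _ _ w hw => hA'box w hw) (fun _ _ => 1) (fun _ _ => ENNReal.one_ne_top), hM₂def,
      sum_eq_sum_boxSources L hA1]
    simp only [sum_eq_sum_boxSources L hA1, ENNReal.toReal_one, one_mul]
    rfl
  have he2r : (∑' p, W p * N p ^ 2).toReal ≤ M₂ * z := by
    refine le_of_mul_le_mul_right ?_ hr0
    calc (∑' p, W p * N p ^ 2).toReal * (Z ∅).toReal
        = (Z ∅ * ∑' p, W p * N p ^ 2).toReal := by rw [ENNReal.toReal_mul, mul_comm]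
      _ ≤ (∑ v ∈ A', ∑ w ∈ A', 1 * Current.twoStepBound K a b v w).toReal :=
          ENNReal.toReal_mono hBB_top h2
      _ = M₂ * z * (Z ∅).toReal := by rw [← hM2]; ring
  -- the probability of `{X ≥ m}`, and the real endgame
  have hP : (doubleCurrentMeasure (freeBoxGraph d L) β ({a} ∆ {b}) ∅).real Sm =
      (∑' p, W p * χ p).toReal / z := doubleCurrentMeasure_real_eq_toReal_div L a b hβ hcsab hcs0 Sm
  rw [hP]
  rcases le_or_gt M₂ 0 with hM2le | hM2pos
  · exact (div_nonpos_of_nonneg_of_nonpos (sq_nonneg _) hM2le).trans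
      (div_nonneg ENNReal.toReal_nonneg hzpos.le)
  rw [div_le_div_iff₀ hM2pos hzpos]
  have hd : 0 ≤ (M₁ - m) * z := mul_nonneg (sub_nonneg.2 hm) hzpos.le
  have hd2 : (M₁ - m) * z ≤ (∑' p, W p * (N p * χ p)).toReal := by
    rw [sub_mul]
    linarith
  have key : (M₁ - m) ^ 2 * z * z ≤ (∑' p, W p * χ p).toReal * M₂ * z :=
    calc (M₁ - m) ^ 2 * z * z = ((M₁ - m) * z) ^ 2 := by ring
      _ ≤ (∑' p, W p * (N p * χ p)).toReal ^ 2 := pow_le_pow_left₀ hd hd2 2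
      _ ≤ (∑' p, W p * χ p).toReal * (∑' p, W p * N p ^ 2).toReal := hCSr
      _ ≤ (∑' p, W p * χ p).toReal * (M₂ * z) :=
          mul_le_mul_of_nonneg_left he2r ENNReal.toReal_nonneg
      _ = (∑' p, W p * χ p).toReal * M₂ * z := by ring
  exact le_of_mul_le_mul_right key hzpos

/-- **Markov for a nonnegative pair functional of the one-arm cluster in the box** (nondegenerate case):
for `φ ≥ 0` and `t > 0`, `P^{{a}∆{b},∅}_{Λ_L,β}[∑_{u ≠ v ∈ C(a) ∩ A} φ(u,v) > t] ≤ E_φ/t`,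
`E_φ = ∑_{v ≠ w ∈ A} φ(v,w) twoStep(v,w)/G(a,b) ≥ E[∑ φ]` (Prop. A.3, second display).
[cite: AizenmanDuminilCopinAnnals2021, arXiv:1912.07973 Appendix A.2, Proposition A.3 (second display)] -/
theorem doubleCurrentMeasure_real_pairSum_gt_le (hβ : 0 ≤ β) (ha : (a : Site d) ∈ box d L)
    (hb : (b : Site d) ∈ box d L)
    (hG : ∀ x y : BoxVertex d L, (x : Site d) ∈ box d L → (y : Site d) ∈ box d L →
      G x y = (ecurrentSum (fun _ : (freeBoxGraph d L).edgeFinset => β) ({x} ∆ {y})).toReal /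
        (ecurrentSum (fun _ : (freeBoxGraph d L).edgeFinset => β) ∅).toReal)
    (hab : G a b ≠ 0) (hA : A ⊆ box d L) (φ : Site d → Site d → ℝ) (hφ : ∀ u v, 0 ≤ φ u v) {t : ℝ}
    (ht : 0 < t) :
    (doubleCurrentMeasure (freeBoxGraph d L) β ({a} ∆ {b}) ∅).real
        {p | t < ∑ u ∈ ((boxSources d L A).filter fun v => v ∈ (p.1 + p.2).cluster a).map (boxEmb d L),
          ∑ v ∈ (((boxSources d L A).filter fun v => v ∈ (p.1 + p.2).cluster a).map (boxEmb d L)).erase u,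
            φ u v} ≤
      (∑ v ∈ A, ∑ w ∈ A.erase v,
          φ v w * ((G a v * G v w * G w b + G a w * G w v * G v b) / G a b)) / t := by
  set K : (freeBoxGraph d L).edgeFinset → ℝ := fun _ => β with hKdef
  have hK : ∀ e', 0 ≤ K e' := fun _ => hβ
  set Z : Finset (BoxVertex d L) → ℝ≥0∞ := ecurrentSum K with hZdef
  have hZtop : ∀ S, Z S ≠ ∞ := fun S => ecurrentSum_ne_top hK S
  have hZ0 : Z ∅ ≠ 0 := ecurrentSum_empty_ne_zero K
  obtain ⟨hZab, hcsab, hcs0⟩ := currentSum_ne_zero_of_ratio_ne_zero L a b G hβ (hG a b ha hb) hab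
  have hr0 : 0 < (Z ∅).toReal := ENNReal.toReal_pos hZ0 (hZtop _)
  have hrab : 0 < (Z ({a} ∆ {b})).toReal := ENNReal.toReal_pos hZab (hZtop _)
  set z : ℝ := (Z ({a} ∆ {b})).toReal * (Z ∅).toReal with hzdef
  have hzpos : 0 < z := mul_pos hrab hr0
  have hA1 : A ⊆ box d (L + 1) := hA.trans (box_subset_box_succ d L)
  set A' : Finset (BoxVertex d L) := boxSources d L A with hA'def
  have hA'box : ∀ v ∈ A', (v : Site d) ∈ box d L := fun v hv => hA (mem_boxSources_iff.1 hv)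
  set E : ℝ := ∑ v ∈ A, ∑ w ∈ A.erase v,
    φ v w * ((G a v * G v w * G w b + G a w * G w v * G v b) / G a b) with hEdef
  -- the weight `W`, the functional `I`, the indicator `χ`
  set W : Current (freeBoxGraph d L) × Current (freeBoxGraph d L) → ℝ≥0∞ :=
    fun p => epairWeight K ({a} ∆ {b}) ∅ p with hWdef
  set F : Current (freeBoxGraph d L) × Current (freeBoxGraph d L) → Finset (BoxVertex d L) :=
    fun p => A'.filter fun v => v ∈ (p.1 + p.2).cluster a with hFdef
  set c : BoxVertex d L → BoxVertex d L → ℝ := fun v w => φ v w with hcdef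
  have hc0 : ∀ v w, 0 ≤ c v w := fun v w => hφ _ _
  set I : Current (freeBoxGraph d L) × Current (freeBoxGraph d L) → ℝ≥0∞ :=
    fun p => ∑ v ∈ A', ∑ w ∈ A'.erase v,
      ENNReal.ofReal (c v w) * (Current.connInd v a p * Current.connInd w a p) with hIdef
  set St : Set (Current (freeBoxGraph d L) × Current (freeBoxGraph d L)) :=
    {p | t < ∑ u ∈ (F p).map (boxEmb d L), ∑ v ∈ ((F p).map (boxEmb d L)).erase u, φ u v}
    with hStdef
  set χ : Current (freeBoxGraph d L) × Current (freeBoxGraph d L) → ℝ≥0∞ := St.indicator 1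
    with hχdef
  have hIeq : ∀ p, ENNReal.ofReal (∑ u ∈ (F p).map (boxEmb d L),
      ∑ v ∈ ((F p).map (boxEmb d L)).erase u, φ u v) = I p := by
    intro p
    rw [sum_map_boxEmb_erase,
      ENNReal.ofReal_sum_of_nonneg (fun v _ => Finset.sum_nonneg fun w _ => hc0 v w), hFdef,
      Finset.sum_filter]
    refine Finset.sum_congr rfl fun v _ => ?_
    by_cases hv : v ∈ (p.1 + p.2).cluster a
    · rw [if_pos hv, ← Finset.filter_erase, Finset.sum_filter,
        ENNReal.ofReal_sum_of_nonneg (fun w _ => ?_)]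
      · refine Finset.sum_congr rfl fun w _ => ?_
        unfold Current.connInd
        rw [if_pos hv, one_mul]
        by_cases hw : w ∈ (p.1 + p.2).cluster a
        · rw [if_pos hw, if_pos hw, mul_one]
        · rw [if_neg hw, if_neg hw, mul_zero, ENNReal.ofReal_zero]
      · by_cases hw : w ∈ (p.1 + p.2).cluster a
        · rw [if_pos hw]; exact hc0 v w
        · rw [if_neg hw]
    · rw [if_neg hv]
      symm
      refine Finset.sum_eq_zero fun w _ => ?_
      unfold Current.connInd
      rw [if_neg hv, zero_mul, mul_zero]
  have hMk : ENNReal.ofReal t * ∑' p, W p * χ p ≤ ∑' p, W p * I p := by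
    rw [← ENNReal.tsum_mul_left]
    refine ENNReal.tsum_le_tsum fun p => ?_
    rw [mul_left_comm]
    refine mul_le_mul' le_rfl ?_
    by_cases hp : p ∈ St
    · rw [hχdef, Set.indicator_of_mem hp, Pi.one_apply, mul_one, ← hIeq]
      exact ENNReal.ofReal_le_ofReal (le_of_lt hp)
    · rw [hχdef, Set.indicator_of_notMem hp, mul_zero]
      exact bot_le
  have h3 : Z ∅ * ∑' p, W p * I p ≤
      ∑ v ∈ A', ∑ w ∈ A'.erase v, ENNReal.ofReal (c v w) * Current.twoStepBound K a b v w :=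
    Current.ecurrentSum_empty_mul_tsum_weightedPairs_le hK A' (fun v => A'.erase v)
      (fun v w => ENNReal.ofReal (c v w)) a b
  -- finiteness and the real forms
  have hS_top : ∑ v ∈ A', ∑ w ∈ A'.erase v, ENNReal.ofReal (c v w) * Current.twoStepBound K a b v w ≠
      ∞ := ENNReal.sum_ne_top.2 fun v _ => ENNReal.sum_ne_top.2 fun w _ =>
        ENNReal.mul_ne_top ENNReal.ofReal_ne_top (Current.twoStepBound_ne_top' hK a b v w)
  have hI_top : ∑' p, W p * I p ≠ ∞ := by
    intro h
    have h3' := h3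
    rw [h, ENNReal.mul_top hZ0, top_le_iff] at h3'
    exact hS_top h3'
  have hEs : E * ((Z ∅).toReal * z) =
      (∑ v ∈ A', ∑ w ∈ A'.erase v, ENNReal.ofReal (c v w) * Current.twoStepBound K a b v w).toReal :=
    by
    rw [toReal_sum_mul_twoStepBound L a b G hβ ha hb hG hab A' (fun v => A'.erase v) hA'box
      (fun _ _ w hw => hA'box w (Finset.mem_of_mem_erase hw)) (fun v w => ENNReal.ofReal (c v w))
      (fun _ _ => ENNReal.ofReal_ne_top), hEdef, sum_eq_sum_boxSources L hA1]
    simp only [sum_erase_eq_sum_boxSources L hA1, ENNReal.toReal_ofReal (hc0 _ _)]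
    rfl
  have hIr : (∑' p, W p * I p).toReal ≤ E * z := by
    refine le_of_mul_le_mul_right ?_ hr0
    calc (∑' p, W p * I p).toReal * (Z ∅).toReal
        = (Z ∅ * ∑' p, W p * I p).toReal := by rw [ENNReal.toReal_mul, mul_comm]
      _ ≤ (∑ v ∈ A', ∑ w ∈ A'.erase v,
            ENNReal.ofReal (c v w) * Current.twoStepBound K a b v w).toReal :=
          ENNReal.toReal_mono hS_top h3
      _ = E * z * (Z ∅).toReal := by rw [← hEs]; ring
  have hMkr : t * (∑' p, W p * χ p).toReal ≤ (∑' p, W p * I p).toReal := by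
    have h := ENNReal.toReal_mono hI_top hMk
    rwa [ENNReal.toReal_mul, ENNReal.toReal_ofReal ht.le] at h
  -- the probability of `{∑ φ > t}`
  have hP : (doubleCurrentMeasure (freeBoxGraph d L) β ({a} ∆ {b}) ∅).real St =
      (∑' p, W p * χ p).toReal / z := doubleCurrentMeasure_real_eq_toReal_div L a b hβ hcsab hcs0 St
  rw [hP, div_le_div_iff₀ hzpos ht]
  linarith

end Box

/-! ### §4. The assembled statement for the trace law `P^{{a}∆{b},∅}_{Λ_L,β}` -/

open Classical in
/-- **One-arm mass and energy of the sourced double-current cluster in a box (Aizenman–Duminil-Copin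
2021, Prop. A.3 with the second-moment method of Lemma 4.4; finite volume).** Let `β ≥ 0`,
`a, b ∈ Λ_L ⊂ ℤ^d`, `A ⊆ Λ_L`, `φ ≥ 0` a pair functional, `0 ≤ m ≤ M₁`, `t > 0`, and let `G` agree with
the free box two-point function `⟨σσ⟩^∅_{Λ_L,β}` on `Λ_L`. Then the box law `P^{{a}∆{b},∅}_{Λ_L,β}` of the
trace of a sourced double current gives the event "the cluster `C(a) = {v ∈ Λ_{L+1} | a ↔ v}` has at
least `m` sites in `A` and `∑_{u ≠ v ∈ C(a) ∩ A} φ(u,v) ≤ t`" probability at least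
`(M₁ − m)²/M₂ − E_φ/t`, where `M₁ = ∑_{v∈A} G(a,v)G(v,b)/G(a,b)` (`= E #(C(a) ∩ A)` exactly, by
switching), `M₂ = ∑_{v,w∈A} twoStep(v,w)/G(a,b) ≥ E #(C(a) ∩ A)²` and
`E_φ = ∑_{v≠w∈A} φ(v,w) twoStep(v,w)/G(a,b) ≥ E ∑ φ` (Prop. A.3),
`twoStep(v,w) = G(a,v)G(v,w)G(w,b) + G(a,w)G(w,v)G(v,b)`; Paley–Zygmund, Markov and the union bound.
Degenerate case `G(a,b) = 0` by `x/0 = 0`. [cite: AizenmanDuminilCopinAnnals2021, arXiv:1912.07973 §4.2, proof of Lemma 4.4, and Appendix A.2, Proposition A.3] -/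
theorem sourcedDoubleCurrentLaw_real_oneArm_ge {d : ℕ} (L : ℕ) {β : ℝ} (hβ : 0 ≤ β)
    (G : Site d → Site d → ℝ)
    (hG : ∀ x y : Site d, x ∈ box d L → y ∈ box d L →
      G x y = isingTwoPoint (zdGraph d) (box d L) β 0 .free x y)
    {a b : Site d} (ha : a ∈ box d L) (hb : b ∈ box d L) {A : Finset (Site d)} (hA : A ⊆ box d L)
    (φ : Site d → Site d → ℝ) (hφ : ∀ u v, 0 ≤ φ u v) {m t : ℝ} (ht : 0 < t) (hm0 : 0 ≤ m)
    (hm : m ≤ ∑ v ∈ A, G a v * G v b / G a b) :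
    (∑ v ∈ A, G a v * G v b / G a b - m) ^ 2 /
          (∑ v ∈ A, ∑ w ∈ A, (G a v * G v w * G w b + G a w * G w v * G v b) / G a b) -
        (∑ v ∈ A, ∑ w ∈ A.erase v,
          φ v w * ((G a v * G v w * G w b + G a w * G w v * G v b) / G a b)) / t ≤
      (sourcedDoubleCurrentLaw d L β ({a} ∆ {b}) ∅).real
        {ω | m ≤ ((((box d (L + 1)).filter fun v => ω ∈ openConn a v) ∩ A).card : ℝ) ∧
          ∑ u ∈ ((box d (L + 1)).filter fun v => ω ∈ openConn a v) ∩ A,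
            ∑ v ∈ (((box d (L + 1)).filter fun v => ω ∈ openConn a v) ∩ A).erase u, φ u v ≤ t} := by
  by_cases hab : G a b = 0
  · have hM1 : ∑ v ∈ A, G a v * G v b / G a b = 0 :=
      Finset.sum_eq_zero fun v _ => by rw [hab, div_zero]
    have hE : ∑ v ∈ A, ∑ w ∈ A.erase v,
        φ v w * ((G a v * G v w * G w b + G a w * G w v * G v b) / G a b) = 0 :=
      Finset.sum_eq_zero fun v _ => Finset.sum_eq_zero fun w _ => by rw [hab, div_zero, mul_zero]
    have hm' : m = 0 := le_antisymm (hM1 ▸ hm) hm0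
    rw [hM1, hm', hE, sub_self, zero_pow two_ne_zero, zero_div, zero_div, sub_zero]
    exact measureReal_nonneg
  -- box vertices
  have hl : ∀ x ∈ box d L, ∃ x' : BoxVertex d L, (x' : Site d) = x := fun x hx =>
    ⟨⟨x, box_subset_box_succ d L hx⟩, rfl⟩
  obtain ⟨⟨a, rfl⟩, ⟨b, rfl⟩⟩ := And.intro (hl a ha) (hl b hb)
  have hG' : ∀ x y : BoxVertex d L, (x : Site d) ∈ box d L → (y : Site d) ∈ box d L →
      G x y = (ecurrentSum (fun _ : (freeBoxGraph d L).edgeFinset => β) ({x} ∆ {y})).toReal /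
        (ecurrentSum (fun _ : (freeBoxGraph d L).edgeFinset => β) ∅).toReal := fun x y hx hy => by
    rw [hG x y hx hy, isingTwoPoint_free_box_eq_toReal_div L hβ x y hx hy]
  -- the law as a push-forward of the (probability) double-current measure `P`
  set P := doubleCurrentMeasure (freeBoxGraph d L) β ({a} ∆ {b}) ∅ with hPdef
  have hlaw : sourcedDoubleCurrentLaw d L β ({(a : Site d)} ∆ {(b : Site d)}) ∅ =
      P.map (sourcedTrace d L) := by
    rw [sourcedDoubleCurrentLaw, boxSources_pair, boxSources_empty]
  obtain ⟨-, hcsab, hcs0⟩ := currentSum_ne_zero_of_ratio_ne_zero L a b G hβ (hG' a b ha hb) hab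
  haveI : IsProbabilityMeasure P := isProbabilityMeasure_doubleCurrentMeasure_holds _ hβ hcsab hcs0
  -- the events, read on pairs of currents
  set F : Current (freeBoxGraph d L) × Current (freeBoxGraph d L) → Finset (BoxVertex d L) :=
    fun p => (boxSources d L A).filter fun v => v ∈ (p.1 + p.2).cluster a with hFdef
  set E : Set (BondConfig (Site d)) :=
    {ω | m ≤ ((((box d (L + 1)).filter fun v => ω ∈ openConn (a : Site d) v) ∩ A).card : ℝ) ∧
      ∑ u ∈ ((box d (L + 1)).filter fun v => ω ∈ openConn (a : Site d) v) ∩ A,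
        ∑ v ∈ (((box d (L + 1)).filter fun v => ω ∈ openConn (a : Site d) v) ∩ A).erase u, φ u v ≤ t}
    with hEdef
  set Sm : Set (Current (freeBoxGraph d L) × Current (freeBoxGraph d L)) :=
    {p | m ≤ ((F p).card : ℝ)} with hSmdef
  set St : Set (Current (freeBoxGraph d L) × Current (freeBoxGraph d L)) :=
    {p | t < ∑ u ∈ (F p).map (boxEmb d L), ∑ v ∈ ((F p).map (boxEmb d L)).erase u, φ u v}
    with hStdef
  have hpre : ∀ p, p ∈ sourcedTrace d L ⁻¹' E ↔ m ≤ ((F p).card : ℝ) ∧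
      ∑ u ∈ (F p).map (boxEmb d L), ∑ v ∈ ((F p).map (boxEmb d L)).erase u, φ u v ≤ t := fun p => by
    rw [Set.mem_preimage, hEdef, Set.mem_setOf_eq, filter_openConn_sourcedTrace_inter L a A p,
      Finset.card_map]
  have hsub : Sm ⊆ sourcedTrace d L ⁻¹' E ∪ St := fun p hp => by
    by_cases h : t < ∑ u ∈ (F p).map (boxEmb d L), ∑ v ∈ ((F p).map (boxEmb d L)).erase u, φ u v
    · exact Or.inr h
    · exact Or.inl ((hpre p).2 ⟨hp, not_lt.1 h⟩)
  have hPZ := doubleCurrentMeasure_real_clusterCount_ge L a b G A hβ ha hb hG' hab hA hm0 hm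
  have hMk := doubleCurrentMeasure_real_pairSum_gt_le L a b G A hβ ha hb hG' hab hA φ hφ ht
  have hU : P.real Sm ≤ P.real (sourcedTrace d L ⁻¹' E) + P.real St :=
    (measureReal_mono hsub (measure_ne_top _ _)).trans (measureReal_union_le _ _)
  have hmap : P.real (sourcedTrace d L ⁻¹' E) ≤ (P.map (sourcedTrace d L)).real E := by
    rw [measureReal_def, measureReal_def]
    exact ENNReal.toReal_mono (measure_ne_top _ _)
      (Measure.le_map_apply (measurable_sourcedTrace L).aemeasurable E)
  rw [hlaw]
  linarith

end Literature.Probability.LatticeModels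

end
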